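import Mathlib
import Summits.KontsevichZagierPeriods.KontsevichZagierPeriods.Theorems.SoloInformedRealParamTransferI
import Summits.KontsevichZagierPeriods.KontsevichZagierPeriods.Theorems.SoloInformedDefMoveChangeOfVariablesI
import Summits.KontsevichZagierPeriods.KontsevichZagierPeriods.Theorems.SoloInformedRealParamLogTwo
import HarnessLib

/-!
# Solo-informed (A390-ii): THEOREMS R and T for ARBITRARY `KZ_ℝ` chains, conditional only on
the Lion–Rolin preparation fact

File F6k — the endgame of the KERNEL LEMMA I programme.  The four (unbounded) KZ moves over `ℝ`
satisfy the definability invariant (`soloInformed_definableRelI_generators`, files F6g–F6j), so the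
conditional THEOREMS R-I / T-I (`SoloInformedRealParamBarrierI`, `SoloInformedRealParamTransferI`)
become theorems conditional on `semialgebraicPreparation` alone:

* **THEOREM R** (`soloInformed_realParameterBarrier_prep`): a `ℚ`-representation with
  transcendental value is not `KZ_ℝ`-related — by ANY chain of the four moves with
  real-semialgebraic data, bounded or not — to a rectangle `[[0,1] × [0,ℓ], 1]`;
* **THEOREM T** (`soloInformed_realParameterTransfer_prep`, `soloInformed_kzEquivalent_iff_real_prep`):
  `KZ_ℝ`-equivalence of base changes of `ℚ`-representations is `KZ_ℚ`-equivalence — real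
  parameters add no relations between `ℚ`-representations;
* the instance `A_{log 2}` (`soloInformed_logTwoRep_not_equivalent_rect_prep`) and the failure of
  the naive real-coefficient analogue of the period conjecture
  (`soloInformed_realCoefficientAnalogue_fails_prep`).

References: [cite: KontsevichZagier2001, §1.2]; [cite: ComteLionRolin2000, Thm. 3];
[cite: LionRolin1998]; [cite: Fresan2024, Ex. 2.5].
-/

noncomputable section

open Set Literature.ModelTheory.ExponentialFields Literature.NumberTheory.Transcendental

namespace Summit.KontsevichZagierPeriods.KontsevichZagierPeriods.Theorems

/-- **The four moves of `KZ_ℝ` (arbitrary representations) are definable**, conditional on the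
preparation fact. [cite: KontsevichZagier2001, §1.2] -/
theorem soloInformed_definableRelI_generators (hprep : semialgebraicPreparation) :
    ∀ c ∈ soloInformedGenerators ℝ, SoloInformedDefinableRelI c := by
  rintro c (((hD | hI) | hC) | hN)
  · exact soloInformed_definableRelI_domainAddRel hprep c hD
  · exact soloInformed_definableRelI_integrandAddRel hprep c hI
  · exact soloInformed_definableRelI_changeOfVariablesRel hprep c hC
  · exact soloInformed_definableRelI_newtonLeibnizRel hprep c hN

/-- Every element of `KZOver.relations ℝ` is definable (conditional on the preparation fact).
[cite: KontsevichZagier2001, §1.2] -/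
theorem soloInformed_definableRelI_of_mem_relations_prep (hprep : semialgebraicPreparation)
    {c : KZOver.FormalRep ℝ} (hc : c ∈ KZOver.relations ℝ) : SoloInformedDefinableRelI c :=
  soloInformed_definableRelI_of_mem_relations (soloInformed_definableRelI_generators hprep) hc

/-! ### THEOREM R -/

/-- **THEOREM R (arbitrary chains).** Conditional on the preparation fact: a `ℚ`-representation
with transcendental value is not `KZ_ℝ`-related to any rectangle `[[0,1] × [0,ℓ], 1]`, `ℓ ≥ 0`.
[cite: KontsevichZagier2001, §1.2, Conjecture 1] -/
theorem soloInformed_realParameterBarrier_prep (hprep : semialgebraicPreparation) {n : ℕ}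
    (r : KZOver.IntegralRep ℚ n) (hτ : Transcendental ℚ r.value) {ℓ : ℝ} (hℓ : 0 ≤ ℓ) :
    KZOver.of (r.baseChange ℝ) - KZOver.of (soloInformedRealRect ℓ) ∉ KZOver.relations ℝ :=
  soloInformed_realParameterBarrierI (soloInformed_definableRelI_generators hprep) r hτ hℓ

/-- **THEOREM R, all heights.** [cite: KontsevichZagier2001, §1.2, Conjecture 1] -/
theorem soloInformed_realParameterBarrier_prep' (hprep : semialgebraicPreparation) {n : ℕ}
    (r : KZOver.IntegralRep ℚ n) (hτ : Transcendental ℚ r.value) (ℓ : ℝ) :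
    ¬ KZOver.Equivalent (r.baseChange ℝ) (soloInformedRealRect ℓ) :=
  soloInformed_realParameterBarrierI' (soloInformed_definableRelI_generators hprep) r hτ ℓ

/-! ### THEOREM T -/

/-- **THEOREM T (arbitrary chains).** Conditional on the preparation fact: a `KZ_ℝ` relation
between base changes of `ℚ`-representations is already a `KZ_ℚ` relation.
[cite: KontsevichZagier2001, §1.2] -/
theorem soloInformed_realParameterTransfer_prep (hprep : semialgebraicPreparation) {n n' : ℕ}
    (r : KZOver.IntegralRep ℚ n) (r' : KZOver.IntegralRep ℚ n')
    (hc : KZOver.of (r.baseChange ℝ) - KZOver.of (r'.baseChange ℝ) ∈ KZOver.relations ℝ) :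
    KZOver.of r - KZOver.of r' ∈ KZOver.relations ℚ :=
  soloInformed_realParameterTransferI (soloInformed_definableRelI_generators hprep) r r' hc

/-- **`KZ_ℝ`-equivalence of base changes is `KZ_ℚ`-equivalence** (conditional on the preparation
fact). [cite: KontsevichZagier2001, §1.2] -/
theorem soloInformed_equivalent_baseChange_iff_prep (hprep : semialgebraicPreparation) {n n' : ℕ}
    (r : KZOver.IntegralRep ℚ n) (r' : KZOver.IntegralRep ℚ n') :
    KZOver.Equivalent (r.baseChange ℝ) (r'.baseChange ℝ) ↔ KZOver.Equivalent r r' :=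
  soloInformed_equivalent_baseChange_iffI (soloInformed_definableRelI_generators hprep) r r'

/-- **THEOREM T on KZ's own representations**: two of KZ's integral representations are
KZ-equivalent iff their real base changes are `KZ_ℝ`-equivalent (conditional on the preparation
fact) — the relation lattice of the conjecture is unchanged by admitting real-semialgebraic data in
the moves. [cite: KontsevichZagier2001, §1.2] -/
theorem soloInformed_kzEquivalent_iff_real_prep (hprep : semialgebraicPreparation) {n n' : ℕ}
    (r : KZ.IntegralRep n) (r' : KZ.IntegralRep n') :
    KZOver.Equivalent (KZOver.IntegralRep.ofKZOver ℝ r) (KZOver.IntegralRep.ofKZOver ℝ r') ↔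
      KZ.Equivalent r r' :=
  soloInformed_kzEquivalent_iff_realI (soloInformed_definableRelI_generators hprep) r r'

/-! ### The instance `A_{log 2}` -/

/-- **`[A_{log 2}] − [[0,1] × [0,ℓ], 1] ∉ relations ℝ`** for every `ℓ ≥ 0` (conditional on the
preparation fact): no chain whatsoever of the four moves with real-semialgebraic data connects
them. [cite: KontsevichZagier2001, §1.2 Conjecture 1] -/
theorem soloInformed_logTwoRep_sub_rect_notMem_relations_prep (hprep : semialgebraicPreparation)
    {ℓ : ℝ} (hℓ : 0 ≤ ℓ) :
    KZOver.of (soloInformedLogTwoRep.baseChange ℝ) - KZOver.of (soloInformedRealRect ℓ) ∉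
      KZOver.relations ℝ :=
  soloInformed_realParameterBarrier_prep hprep soloInformedLogTwoRep
    soloInformed_transcendental_value_logTwoRep hℓ

/-- **`A_{log 2}` is not `KZ_ℝ`-equivalent to any rectangle** (conditional on the preparation
fact). [cite: KontsevichZagier2001, §1.2 Conjecture 1] -/
theorem soloInformed_logTwoRep_not_equivalent_rect_prep (hprep : semialgebraicPreparation)
    (ℓ : ℝ) :
    ¬ KZOver.Equivalent (soloInformedLogTwoRep.baseChange ℝ) (soloInformedRealRect ℓ) :=
  soloInformed_realParameterBarrier_prep' hprep soloInformedLogTwoRep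
    soloInformed_transcendental_value_logTwoRep ℓ

/-- **The naive real-coefficient analogue of the period conjecture fails** (conditional on the
preparation fact): `A_{log 2}` and the rectangle of area `log 2` are `KZ_ℝ` integral
representations with equal values that are not `KZ_ℝ`-equivalent.
[cite: KontsevichZagier2001, §1.2 Conjecture 1] -/
theorem soloInformed_realCoefficientAnalogue_fails_prep (hprep : semialgebraicPreparation) :
    ¬ (∀ (n m : ℕ) (r : KZOver.IntegralRep ℝ n) (r' : KZOver.IntegralRep ℝ m),
        r.value = r'.value → KZOver.Equivalent r r') := fun h =>
  soloInformed_logTwoRep_not_equivalent_rect_prep hprep (Real.log 2)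
    (h _ _ _ _ soloInformed_value_logTwoRep_eq_value_rect)

end Summit.KontsevichZagierPeriods.KontsevichZagierPeriods.Theorems
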